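import Summits.QuantumFields.BalabanUV.T4Continuum.Support.NE3MajorantProfileFrames
import Summits.QuantumFields.BalabanUV.T4Continuum.Support.NE3BoxRestrictionPeriodic
import Summits.QuantumFields.BalabanUV.T4Continuum.Support.AveragingDeficitLiftDefectSum
import Summits.QuantumFields.BalabanUV.T4Continuum.Support.NE3SmoothLiftW
import HarnessLib

/-!
# T⁴ programme, node NE3, route Π (Γ″) · γ4″ (THE END) — THE COULOMB-PROFILE LETTER OF THE LINEARISED k-FOLD AVERAGE, BOX-LOCAL FORM
# `‖Y(b)‖ ≤ σ + β·Σ_{c∈S} prof d (b₋ − c)` on `B^k(c₋) ∪ B^k(c₊)` ⟹ `‖dirIter L k W Y z κ‖ ≤ Aσ d·L^k·σ + Bβ d L·|S|·β` (k-FREE, d ≥ 4)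

NE3 formalisation swarm `b2b-balaban-t4-ne3-formalise-*`, LEAF PROVER 04 (gen 8) — the letter `hlin` consumed VERBATIM by the Π-C-3γ holder
leaf-02-g8's γ-END `NE3QuadRemainderGaugedEnd.norm_dirIter_le_of_gaugedTwoTierData` (journal HOME/CLAIMS.log l.25119 «NOT MINE — GO» with the
signature, l.25283 δ1–δ3, l.25351 «YES, ALL THREE»).  Assembles files A (`NE3QbarIterMajorant`), A′ (`NE3DirIterMajorant`), B1–B3
(`NE3MajorantProfile`, `NE3MajorantProfileTower`, `NE3MajorantProfileFrames`) with leaf-04-g7's periodised restriction `NE3BoxRestrictionPeriodic`.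

THE STATEMENT (`k = j+1` levels).  DATA: `profd d v := ((1 + |v|₁∕2)^(d−2))⁻¹` (the ℓ¹ lattice-Coulomb POTENTIAL profile adopted by NE3-R2
D-12-4), `Aσ d := 2 + 8d`, `Bβ d L := (2(nbRad d L + 3) + 1)^d · (2 + 8dL) · cP d (d−2)`.  CLASS at `W`: unitary, `(L^{j+1}·N)`-periodic, `0 ≤ x`,
`LevelSmall d L (j+1) x`, `SmallField W x` (Π-C's tower class minus `curvSum`, unused by a LINEAR letter) + ONE k-free regime line
`hK : cK d L (d−2) · Ssum d L (j+1) x ≤ 1∕2` (the Grönwall product of file B2 is then `≤ 2`; `Ssum ≤ (4∕3)·wC(top radius)` by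
`NE3CovariantLineSumsError.Ssum_le_one`).  For EVERY skew `(L^{j+1}·N)`-periodic `Y`, finite `S ⊂ ℤ^d` (ANY fine points), `σ, β ≥ 0` with
`‖Y y μ‖ ≤ σ + β·Σ_{c∈S} profd d (y − c)` on the bonds of the box of record `[loK L (j+1) z, bondHiK L (j+1) z κ]`:
**`‖dirIter L (j+1) W Y z κ‖ ≤ Aσ d · L^{j+1} · σ + Bβ d L · S.card · β`.**

THE PROOF.  Periodise `Y` off the torus orbit of the box (`perRestrict`: agrees on the box, stays skew∕periodic, `dirIter` unchanged by Π-C's box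
locality); on Π-C-3d's dependency balls a non-zero bond of the periodised field is a `P•t`-translate of a box bond with `|t|_∞ ≤ nbRad + 3`
(`depRad ≤ nbRad·L^{j+1}`, `P ≥ L^{j+1}`), so by periodicity it is dominated by `σ + β·Σ_{|t|_∞ ≤ nbRad+3} Σ_{c∈S} prof (d−2) (c − P•t)` —
finitely many RE-CENTRED profiles, k-free in number; then A′'s `norm_dirIter_le_majorant_local`, exact linearity of the towers, and the k-free
evaluations of B2∕B3 (σ-tier `2L^{j+1} + 2·4dL^{j+1}`; each profile `cP·Kprod·L^{j+1}∕(L^{j+1})^{d−2}·prof ≤ 2cP` plus frames `2·2dL·cP·2`).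

HONEST: kinematic positivity bookkeeping + real analysis on `ℤ^d` on OUR frame; the hypotheses are Π-C's tower class and a displayed domination;
nothing about minimisers, (Π-REG-γ″), Π-C-3γ″, T-E_w♯ or NE3 is asserted; NE3 NOT proved; spine PROVED 0∕9; finite T⁴ rung (B)+1 — NOT infinite
volume, NOT mass gap, NOT BetaPertH, NOT Clay.  PLACEMENT: `Summits/QuantumFields/BalabanUV/` (cell rule).
-/

set_option autoImplicit false

open scoped BigOperators Matrix.Norms.L2Operator
open Finset

namespace Summit.QuantumFields.BalabanUV.T4Continuum.NE3LinearTowerProfile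

open Literature.MathematicalPhysics.QuantumFieldTheory.Balaban1983to89
open B7Prop1Explicit B7Prop2Explicit
open B7Prop1Local (InBox loK bondHiK)
open B7Prop5Flat (BondIn)
open T4AveragingDeficitWall (IsUnitaryCfg IsSkewDir SmallField box)
open T4AveragingDeficitWallBoundary (IsPeriodicCfg)
open AveragingDeficitPeriodicCounting (IsPeriodicDir)
open AveragingDeficitCounting (mem_box_iff card_box_eq blockIdx)
open AveragingDeficitTorusChart (periodic_smul_vec)
open AveragingDeficitTwoLevelPrep (prop1Radius)
open AveragingDeficitMultiLevelPrep (tower LevelSmall prop1Radius_nonneg)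
open BlockAverageVaryHolo (nbRad)
open NE3QuadRemainderLocality (depRad depRad_add_le)
open NE3TangentCovariantTower (dirIter)
open NE3CovariantLineSumsError (Csup wC Ssum Ssum_nonneg Ssum_le_one sq_mul_le_prop1Radius)
open NE3BoxRestrictionPeriodic (perRestrict perRestrict_of_exists perRestrict_of_not isPeriodicDir_perRestrict isSkewDir_perRestrict
  dirIter_eq_dirIter_perRestrict)
open NE3QbarIterMajorant (majIter majIter_add majIter_smul majIter_mono majIter_nonneg)
open NE3DirIterMajorant (frameMaj frameMaj_add frameMaj_smul frameMaj_mono frameMaj_nonneg norm_dirIter_le_majorant_local)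
open NE3MajorantProfile (prof profW prof_nonneg prof_le_one cP cP_nonneg)
open NE3MajorantProfileTower (Lprod Lprod_le majIter_const_le cK cK_nonneg Kprod one_le_Kprod Kprod_le_two majIter_iterate_profW_le)
open NE3MajorantProfileFrames (Ssum_mono frameMaj_const_le frameMaj_profW_le)
open AveragingDeficitLiftDefectSum (natAbs_le_l1)
open NE3SmoothLiftW (tower_eq_pow_mul)

noncomputable section

variable {d : ℕ}

/-! ## §1 The data: the profile of record and the two constants -/

/-- THE ℓ¹ LATTICE-COULOMB POTENTIAL PROFILE of route Γ″: `profd d v = (1 + |v|₁∕2)^{−(d−2)}` (NE3-R2 D-12-4 (q2): dominates the measured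
spike profile of the residual slice representative at d = 3, 4). [folklore] -/
def profd (d : ℕ) (v : Site d) : ℝ := ((1 + (l1 v : ℝ) / 2) ^ (d - 2))⁻¹

/-- `profd d (y − c) = prof (d−2) c y`. [folklore] -/
theorem profd_eq (d : ℕ) (c y : Site d) : profd d (y - c) = prof (d - 2) c y := rfl

/-- `0 ≤ profd`. [folklore] -/
theorem profd_nonneg (d : ℕ) (v : Site d) : 0 ≤ profd d v := by unfold profd; positivity

/-- `profd ≤ 1`. [folklore] -/
theorem profd_le_one (d : ℕ) (v : Site d) : profd d v ≤ 1 := by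
  unfold profd
  have h1 : (1 : ℝ) ≤ (1 + (l1 v : ℝ) / 2) ^ (d - 2) := one_le_pow₀ (by have := Nat.cast_nonneg (α := ℝ) (l1 v); linarith)
  exact inv_le_one_of_one_le₀ h1

/-- THE σ-CONSTANT `Aσ d = 2 + 8d` (straight tower `2`, two accumulated frames `4d` each). [folklore] -/
def Aσ (d : ℕ) : ℝ := 2 + 8 * d

/-- THE β-CONSTANT `Bβ d L = (2(nbRad+3)+1)^d · (2 + 8dL) · cP d (d−2)` (number of periodic images of the box meeting the dependency balls ×
(straight tower `2cP` + two frame towers `4dL·cP` each)). [folklore] -/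
def Bβ (d L : ℕ) : ℝ := ((2 * (nbRad d L + 3) + 1 : ℕ) : ℝ) ^ d * ((2 + 8 * (d * L : ℝ)) * cP d (d - 2))

/-- `0 ≤ Aσ`. [folklore] -/
theorem Aσ_nonneg (d : ℕ) : 0 ≤ Aσ d := by unfold Aσ; positivity

/-- `0 ≤ Bβ`. [folklore] -/
theorem Bβ_nonneg (d L : ℕ) : 0 ≤ Bβ d L := by unfold Bβ; have := cP_nonneg d (d - 2); positivity

/-! ## §2 Bookkeeping: linearity over finite sums, the witness confinement (`tower_eq_pow_mul`, `natAbs_le_l1` BY NAME from the tree) -/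

/-- `majIter` of a finite sum of weights. [folklore] -/
theorem majIter_finset_sum {ι : Type*} (d L j : ℕ) (x : ℝ) (A : Finset ι) (f : ι → Site d → Fin d → ℝ) (z : Site d) (κ : Fin d) :
    majIter d L j x (fun y μ => ∑ a ∈ A, f a y μ) z κ = ∑ a ∈ A, majIter d L j x (f a) z κ := by
  classical
  induction A using Finset.induction_on with
  | empty =>
      have h := majIter_smul d L j x 0 (fun (_ : Site d) (_ : Fin d) => (0 : ℝ))
      simp only [zero_mul] at h
      simpa using congrFun (congrFun h z) κ
  | insert a A ha ih =>
      simp only [Finset.sum_insert ha]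
      have h := majIter_add d L j x (f a) (fun y μ => ∑ a ∈ A, f a y μ)
      rw [show (fun y μ => f a y μ + ∑ a ∈ A, f a y μ) = (fun y μ => f a y μ + (fun y μ => ∑ a ∈ A, f a y μ) y μ) from rfl, h]
      simp only [ih]

/-- `frameMaj` of a finite sum of weights. [folklore] -/
theorem frameMaj_finset_sum {ι : Type*} (d L j : ℕ) (x : ℝ) (A : Finset ι) (f : ι → Site d → Fin d → ℝ) (z : Site d) :
    frameMaj d L j x (fun y μ => ∑ a ∈ A, f a y μ) z = ∑ a ∈ A, frameMaj d L j x (f a) z := by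
  classical
  induction A using Finset.induction_on with
  | empty =>
      have h := frameMaj_smul d L j x 0 (fun (_ : Site d) (_ : Fin d) => (0 : ℝ)) z
      simp only [zero_mul] at h
      simpa using h
  | insert a A ha ih =>
      simp only [Finset.sum_insert ha]
      have h := frameMaj_add d L j x (f a) (fun y μ => ∑ a ∈ A, f a y μ) z
      rw [show (fun y μ => f a y μ + ∑ a ∈ A, f a y μ) = (fun y μ => f a y μ + (fun y μ => ∑ a ∈ A, f a y μ) y μ) from rfl, h, ih]

/-- **WITNESS CONFINEMENT**: if a `P•t`-translate (`P = L^{j+1}·N`, `N ≥ 1`) of a bond starting in one of Π-C-3d's two dependency balls of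
`(z, κ)` lies in the box of record `[loK L (j+1) z, bondHiK L (j+1) z κ]`, then `|t|_∞ ≤ nbRad + 3`. [folklore] -/
theorem witness_mem_box {L N : ℕ} (hL : 2 ≤ L) (hN : 1 ≤ N) (j : ℕ) (z : Site d) (κ μ : Fin d) {y t : Site d}
    (hy : l1 (y - ((L : ℤ) ^ (j + 1)) • z) ≤ depRad d L (j + 1) ∨ l1 (y - ((L : ℤ) ^ (j + 1)) • (z + e κ)) ≤ depRad d L (j + 1))
    (ht : BondIn (loK L (j + 1) z) (bondHiK L (j + 1) z κ) (y + (((L ^ (j + 1) * N : ℕ) : ℤ)) • t) μ) :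
    t ∈ box (nbRad d L + 3) (0 : Site d) := by
  rw [mem_box_iff]
  intro i
  simp only [Pi.zero_apply, sub_zero]
  set M : ℤ := (L : ℤ) ^ (j + 1) with hM
  have hM1 : 1 ≤ M := by rw [hM]; exact one_le_pow₀ (by exact_mod_cast (by omega : 1 ≤ L))
  have hdep := depRad_add_le (d := d) hL (j + 1)
  obtain ⟨hlo, hhi⟩ := ht.1 i
  simp only [loK, bondHiK, Pi.add_apply, Pi.smul_apply, smul_eq_mul] at hlo hhi
  -- `|y_i − M z_i| ≤ depRad + M`
  have hyz : |y i - M * z i| ≤ (depRad d L (j + 1) : ℤ) + M := by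
    rcases hy with h | h
    · have h1 := natAbs_le_l1 (y - M • z) i
      have h2 : ((y - M • z) i).natAbs ≤ depRad d L (j + 1) := h1.trans h
      have h3 : |(y - M • z) i| ≤ (depRad d L (j + 1) : ℤ) := by rw [Int.abs_eq_natAbs]; exact_mod_cast h2
      simp only [Pi.sub_apply, Pi.smul_apply, smul_eq_mul] at h3
      linarith [abs_nonneg (y i - M * z i)]
    · have h1 := natAbs_le_l1 (y - M • (z + e κ)) i
      have h2 : ((y - M • (z + e κ)) i).natAbs ≤ depRad d L (j + 1) := h1.trans h
      have h3 : |(y - M • (z + e κ)) i| ≤ (depRad d L (j + 1) : ℤ) := by rw [Int.abs_eq_natAbs]; exact_mod_cast h2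
      simp only [Pi.sub_apply, Pi.smul_apply, Pi.add_apply, smul_eq_mul, e_apply] at h3
      rw [abs_le] at h3 ⊢
      constructor
      · split_ifs at h3 <;> nlinarith [h3.1, h3.2]
      · split_ifs at h3 <;> nlinarith [h3.1, h3.2]
  -- `depRad (j+1) + nbRad ≤ nbRad·M`
  have hdep' : (depRad d L (j + 1) : ℤ) ≤ (nbRad d L : ℤ) * M := by
    have : ((depRad d L (j + 1) + nbRad d L : ℕ) : ℤ) ≤ ((nbRad d L * L ^ (j + 1) : ℕ) : ℤ) := by exact_mod_cast hdep
    push_cast at this; rw [hM]; linarith [Int.natCast_nonneg (nbRad d L)]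
  -- the translate: `M z_i ≤ y_i + P t_i ≤ M z_i + (M − 1) + M`
  have hP : (((L ^ (j + 1) * N : ℕ) : ℤ)) = M * N := by push_cast; rw [hM]
  rw [hP] at hlo hhi
  have hhi' : y i + M * N * t i ≤ M * z i + (M - 1) + M := by
    split_ifs at hhi <;> linarith
  have hN1 : (1 : ℤ) ≤ N := by exact_mod_cast hN
  have habs : |M * N * t i| ≤ ((nbRad d L : ℤ) + 3) * M := by
    rw [abs_le] at hyz ⊢
    constructor <;> nlinarith [hyz.1, hyz.2]
  have hM0 : (0 : ℤ) < M := by linarith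
  have hti : |t i| * M ≤ ((nbRad d L : ℤ) + 3) * M := by
    calc |t i| * M ≤ |t i| * (M * N) := by
          rw [← mul_assoc]; exact le_mul_of_one_le_right (by positivity) hN1
      _ = |M * N * t i| := by
          rw [abs_mul, abs_mul, abs_of_pos hM0, abs_of_pos (by linarith : (0 : ℤ) < N)]; ring
      _ ≤ _ := habs
  have := le_of_mul_le_mul_right hti hM0
  exact_mod_cast this

/-! ## §3 THE END -/

/-- **γ4″ — THE COULOMB-PROFILE LETTER OF THE LINEARISED k-FOLD AVERAGE, BOX-LOCAL (the `hlin` of leaf-02-g8's γ-END, VERBATIM).**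
`4 ≤ d`, `2 ≤ L`; CLASS at `W`: unitary, `IsPeriodicCfg W (L^{j+1}·N)`, `0 ≤ x`, `LevelSmall d L (j+1) x`, `SmallField W x`, and the ONE k-free
regime line `cK d L (d−2)·Ssum d L (j+1) x ≤ 1∕2`; then for EVERY skew `(L^{j+1}·N)`-periodic `Y`, EVERY finite `S ⊂ ℤ^d`, `σ, β ≥ 0` with
`‖Y y μ‖ ≤ σ + β·Σ_{c∈S} profd d (y − c)` on the bonds of `[loK L (j+1) z, bondHiK L (j+1) z κ]`:
`‖dirIter L (j+1) W Y z κ‖ ≤ Aσ d·L^{j+1}·σ + Bβ d L·S.card·β`. [folklore] -/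
theorem norm_dirIter_le_of_profile {n : Type*} [Fintype n] [DecidableEq n] [Nonempty n] {L N : ℕ} [NeZero N] (hd : 4 ≤ d) (hL : 2 ≤ L)
    (j : ℕ) {W : Site d → Fin d → (Matrix n n ℂ)ˣ} {x : ℝ} (hWu : IsUnitaryCfg W) (hWP : IsPeriodicCfg W ((L ^ (j + 1) * N : ℕ) : ℤ))
    (hx : 0 ≤ x) (hsm : LevelSmall d L (j + 1) x) (hWx : SmallField W x) (hK : cK d L (d - 2) * Ssum d L (j + 1) x ≤ 1 / 2)
    (z : Site d) (κ : Fin d) {Y : Site d → Fin d → Matrix n n ℂ} (hYs : IsSkewDir Y) (hYP : IsPeriodicDir Y ((L ^ (j + 1) * N : ℕ) : ℤ))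
    (S : Finset (Site d)) {σ β : ℝ} (hσ : 0 ≤ σ) (hβ : 0 ≤ β)
    (hY : ∀ (y : Site d) (μ : Fin d), InBox (loK L (j + 1) z) (bondHiK L (j + 1) z κ) y →
      InBox (loK L (j + 1) z) (bondHiK L (j + 1) z κ) (y + e μ) → ‖Y y μ‖ ≤ σ + β * ∑ c ∈ S, profd d (y - c)) :
    ‖dirIter L (j + 1) W Y z κ‖ ≤ Aσ d * (L : ℝ) ^ (j + 1) * σ + Bβ d L * S.card * β := by
  classical
  have hL1 : 1 ≤ L := by omega
  have hd1 : 1 ≤ d := by omega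
  have hN : 1 ≤ N := Nat.one_le_iff_ne_zero.mpr (NeZero.ne N)
  set p : ℕ := d - 2 with hpdef
  have hp2 : 2 ≤ p := by omega
  have hp1 : 1 ≤ p := by omega
  have hpd : p + 1 ≤ d := by omega
  set P : ℤ := (((L ^ (j + 1) * N : ℕ) : ℤ)) with hPdef
  set lo : Site d := loK L (j + 1) z
  set hi : Site d := bondHiK L (j + 1) z κ
  -- §a the periodised restriction
  set Y' := perRestrict P lo hi Y with hY'
  have hdir : dirIter L (j + 1) W Y z κ = dirIter L (j + 1) W Y' z κ := dirIter_eq_dirIter_perRestrict hL1 (j + 1) P W Y z κ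
  have hY's : IsSkewDir Y' := isSkewDir_perRestrict P lo hi hYs
  have hY'P : IsPeriodicDir Y' P := isPeriodicDir_perRestrict lo hi hYP
  -- §b the class one level down, the period as a tower
  have htow : ((tower L N (j + 1) : ℕ) : ℤ) = P := by rw [tower_eq_pow_mul]
  have hWP' : IsPeriodicCfg W ((tower L N (j + 1) : ℕ) : ℤ) := by rw [htow]; exact hWP
  have hY'P' : IsPeriodicDir Y' ((tower L N (j + 1) : ℕ) : ℤ) := by rw [htow]; exact hY'P
  have hxp : x ≤ prop1Radius d L x := by
    have h := sq_mul_le_prop1Radius (d := d) L x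
    have hL1r : (1 : ℝ) ≤ (L : ℝ) ^ 2 := one_le_pow₀ (by exact_mod_cast hL1)
    nlinarith
  have hsj : LevelSmall d L j x := LevelSmall.mono hx hxp hsm.2
  have hS1 : Ssum d L (j + 1) x ≤ 1 := by have h := Ssum_le_one (d := d) hL hx hsj; exact h.1.trans h.2
  -- §c the dominating weight: finitely many re-centred profiles
  set T : Finset (Site d) := box (nbRad d L + 3) (0 : Site d) with hT
  set Q : Finset (Site d × Site d) := T ×ˢ S with hQ
  set ω : Site d → Fin d → ℝ := fun y _ => σ + β * ∑ q ∈ Q, prof p (q.2 - P • q.1) y with hω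
  have hω0 : ∀ (y : Site d) (μ : Fin d), 0 ≤ ω y μ := fun y μ => by
    simp only [hω]
    exact add_nonneg hσ (mul_nonneg hβ (Finset.sum_nonneg fun q _ => prof_nonneg _ _ _))
  have hdom : ∀ (y : Site d) (μ : Fin d), (l1 (y - ((L : ℤ) ^ (j + 1)) • z) ≤ depRad d L (j + 1)
      ∨ l1 (y - ((L : ℤ) ^ (j + 1)) • (z + e κ)) ≤ depRad d L (j + 1)) → ‖Y' y μ‖ ≤ ω y μ := by
    intro y μ hyball
    by_cases hex : ∃ t : Site d, BondIn lo hi (y + P • t) μ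
    · obtain ⟨t, ht⟩ := hex
      have htT : t ∈ T := witness_mem_box hL hN j z κ μ hyball (by rw [hPdef] at ht; exact ht)
      rw [hY', perRestrict_of_exists Y ⟨t, ht⟩]
      have hper : Y (y + P • t) μ = Y y μ := periodic_smul_vec (f := fun y' => Y y' μ) (fun y' i => hYP y' i μ) y t
      rw [← hper]
      have hbox := hY (y + P • t) μ ht.1 ht.2
      refine hbox.trans ?_
      simp only [hω]
      refine add_le_add le_rfl (mul_le_mul_of_nonneg_left ?_ hβ)
      -- the `t`-slice of the double sum
      have hslice : ∑ c ∈ S, profd d (y + P • t - c) = ∑ q ∈ ({t} : Finset (Site d)) ×ˢ S, prof p (q.2 - P • q.1) y := by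
        rw [Finset.sum_product, Finset.sum_singleton]
        refine Finset.sum_congr rfl fun c _ => ?_
        have e1 : y + P • t - c = y - (c - P • t) := by abel
        rw [e1, profd_eq]
      rw [hslice]
      refine Finset.sum_le_sum_of_subset_of_nonneg ?_ (fun q _ _ => prof_nonneg _ _ _)
      rw [hQ]
      exact Finset.product_subset_product (Finset.singleton_subset_iff.mpr htT) le_rfl
    · rw [hY', perRestrict_of_not Y hex, norm_zero]
      exact hω0 y μ
  -- §d the domination of `dirIter` by the towers
  have hmain := norm_dirIter_le_majorant_local (M := N) hL1 j hWu hWP' hx hsj hWx hY's hY'P' z κ hdom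
  rw [← hdir] at hmain
  refine hmain.trans ?_
  -- §e linearity: ω = const σ + β • Σ_q profW
  have hωeq : ω = fun y μ => (fun (_ : Site d) (_ : Fin d) => σ) y μ
      + (fun y' μ' => β * (fun y'' μ'' => ∑ q ∈ Q, profW p (q.2 - P • q.1) y'' μ'') y' μ') y μ := by
    funext y μ; simp only [hω, profW]
  have hmaj : majIter d L (j + 1) x ω z κ = majIter d L (j + 1) x (fun (_ : Site d) (_ : Fin d) => σ) z κ
      + β * ∑ q ∈ Q, majIter d L (j + 1) x (profW p (q.2 - P • q.1)) z κ := by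
    rw [hωeq, majIter_add]
    simp only
    rw [majIter_smul]
    simp only
    rw [majIter_finset_sum]
  have hfr : ∀ w : Site d, frameMaj d L (j + 1) x ω w = frameMaj d L (j + 1) x (fun (_ : Site d) (_ : Fin d) => σ) w
      + β * ∑ q ∈ Q, frameMaj d L (j + 1) x (profW p (q.2 - P • q.1)) w := by
    intro w
    rw [hωeq, frameMaj_add, frameMaj_smul, frameMaj_finset_sum]
  -- §f the k-free evaluations
  have hM1 : majIter d L (j + 1) x (fun (_ : Site d) (_ : Fin d) => σ) z κ ≤ 2 * (L : ℝ) ^ (j + 1) * σ :=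
    (majIter_const_le hL1 (j + 1) hx hσ z κ).trans (mul_le_mul_of_nonneg_right (Lprod_le hL (j + 1) hx hS1) hσ)
  have hF1 : ∀ w : Site d, frameMaj d L (j + 1) x (fun (_ : Site d) (_ : Fin d) => σ) w ≤ 4 * d * (L : ℝ) ^ (j + 1) * σ :=
    fun w => frameMaj_const_le hL j hx hS1 hσ w
  have hKi : ∀ i ≤ j + 1, Kprod d L p i x ≤ 2 := fun i hi =>
    Kprod_le_two d L p i hx ((mul_le_mul_of_nonneg_left (Ssum_mono d L hi hx) (cK_nonneg d L p)).trans hK)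
  have hM2 : ∀ c : Site d, majIter d L (j + 1) x (profW p c) z κ ≤ 2 * cP d p := by
    intro c
    have h := majIter_iterate_profW_le hd1 hp1 hpd hL1 (j + 1) 0 hx c z κ
    rw [Function.iterate_zero, id_eq] at h
    have hc := cP_nonneg d p
    have hK2 := hKi (j + 1) le_rfl
    have hK1 := one_le_Kprod d L p (j + 1) hx
    have hρ1 : (L : ℝ) ^ (0 + (j + 1)) / ((L : ℝ) ^ (0 + (j + 1))) ^ p ≤ 1 := by
      rw [zero_add, div_le_one (by positivity)]
      calc (L : ℝ) ^ (j + 1) = ((L : ℝ) ^ (j + 1)) ^ 1 := (pow_one _).symm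
        _ ≤ ((L : ℝ) ^ (j + 1)) ^ p := pow_le_pow_right₀ (one_le_pow₀ (by exact_mod_cast hL1)) hp1
    have hρ0 : 0 ≤ (L : ℝ) ^ (0 + (j + 1)) / ((L : ℝ) ^ (0 + (j + 1))) ^ p := by positivity
    have hpr1 := prof_le_one p (blockIdx (L ^ (0 + (j + 1))) c) z
    have hpr0 := prof_nonneg p (blockIdx (L ^ (0 + (j + 1))) c) z
    calc _ ≤ cP d p * Kprod d L p (j + 1) x * ((L : ℝ) ^ (0 + (j + 1)) / ((L : ℝ) ^ (0 + (j + 1))) ^ p)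
          * prof p (blockIdx (L ^ (0 + (j + 1))) c) z := h
      _ ≤ cP d p * 2 * 1 * 1 := by
          have h12 : cP d p * Kprod d L p (j + 1) x ≤ cP d p * 2 := mul_le_mul_of_nonneg_left hK2 hc
          have h12' : 0 ≤ cP d p * Kprod d L p (j + 1) x := by positivity
          calc _ ≤ cP d p * Kprod d L p (j + 1) x * 1 * 1 := by
                refine mul_le_mul (mul_le_mul_of_nonneg_left hρ1 h12') hpr1 hpr0 (by positivity)
            _ ≤ cP d p * 2 * 1 * 1 := by nlinarith
      _ = 2 * cP d p := by ring
  have hF2 : ∀ (c w : Site d), frameMaj d L (j + 1) x (profW p c) w ≤ 2 * (d * L) * cP d p * 2 :=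
    fun c w => frameMaj_profW_le hd1 hp2 hpd hL j hx (fun i hi => hKi i (by omega)) c w
  -- §g assemble
  have hcardT : (T.card : ℝ) = ((2 * (nbRad d L + 3) + 1 : ℕ) : ℝ) ^ d := by rw [hT, card_box_eq]; push_cast; ring
  have hcardQ : (Q.card : ℝ) = ((2 * (nbRad d L + 3) + 1 : ℕ) : ℝ) ^ d * S.card := by rw [hQ, Finset.card_product, Nat.cast_mul, hcardT]
  have hc := cP_nonneg d p
  have hsumM : ∑ q ∈ Q, majIter d L (j + 1) x (profW p (q.2 - P • q.1)) z κ ≤ Q.card * (2 * cP d p) := by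
    calc _ ≤ ∑ _q ∈ Q, 2 * cP d p := Finset.sum_le_sum fun q _ => hM2 _
      _ = _ := by rw [Finset.sum_const, nsmul_eq_mul]
  have hsumF : ∀ w : Site d, ∑ q ∈ Q, frameMaj d L (j + 1) x (profW p (q.2 - P • q.1)) w ≤ Q.card * (2 * (d * L) * cP d p * 2) := by
    intro w
    calc _ ≤ ∑ _q ∈ Q, 2 * (d * L) * cP d p * 2 := Finset.sum_le_sum fun q _ => hF2 _ w
      _ = _ := by rw [Finset.sum_const, nsmul_eq_mul]
  rw [hmaj, hfr z, hfr (z + e κ)]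
  have hd0 : (0 : ℝ) ≤ d := Nat.cast_nonneg d
  have hL0 : (0 : ℝ) ≤ L := Nat.cast_nonneg L
  have hQ0 : (0 : ℝ) ≤ Q.card := Nat.cast_nonneg _
  have hLj : (0 : ℝ) ≤ (L : ℝ) ^ (j + 1) := by positivity
  calc majIter d L (j + 1) x (fun _ _ => σ) z κ + β * ∑ q ∈ Q, majIter d L (j + 1) x (profW p (q.2 - P • q.1)) z κ
        + (frameMaj d L (j + 1) x (fun _ _ => σ) z + β * ∑ q ∈ Q, frameMaj d L (j + 1) x (profW p (q.2 - P • q.1)) z)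
        + (frameMaj d L (j + 1) x (fun _ _ => σ) (z + e κ) + β * ∑ q ∈ Q, frameMaj d L (j + 1) x (profW p (q.2 - P • q.1)) (z + e κ))
      ≤ 2 * (L : ℝ) ^ (j + 1) * σ + β * (Q.card * (2 * cP d p))
        + (4 * d * (L : ℝ) ^ (j + 1) * σ + β * (Q.card * (2 * (d * L) * cP d p * 2)))
        + (4 * d * (L : ℝ) ^ (j + 1) * σ + β * (Q.card * (2 * (d * L) * cP d p * 2))) := by
          have e1 := mul_le_mul_of_nonneg_left hsumM hβ
          have e2 := mul_le_mul_of_nonneg_left (hsumF z) hβ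
          have e3 := mul_le_mul_of_nonneg_left (hsumF (z + e κ)) hβ
          linarith [hM1, hF1 z, hF1 (z + e κ)]
    _ = Aσ d * (L : ℝ) ^ (j + 1) * σ + Bβ d L * S.card * β := by
          rw [hcardQ]; unfold Aσ Bβ; ring

end

end Summit.QuantumFields.BalabanUV.T4Continuum.NE3LinearTowerProfile
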